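import Mathlib
import Summits.ValiantsHypothesis.ValiantsHypothesis.Theorems.LacunarySymmetroidMatrixDescartesCensusRealExponentsTwoByTwoKit

/-!
# `MatrixDescartes` census — ABSTRACT form of the non-sharp transfer: zeros ⇒ sign variations for a balanced perturbation family

HONEST FRAMING.  Object-search cell `pub-symmetroid`, items `DoorA26` (stmt-ValiantsHypothesis-19979) /
`DoorA34` (stmt-ValiantsHypothesis-19980) and their non-sharp rows; this file isolates the ANALYTIC core of
`exists_signVar_of_zeros_two` (`…TwoByTwoSignVar`) from the `2 × 2` algebra, so that the `3 × 3` (and general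
`m`) transfer reduces to a matrix-algebra lemma (report DOOR-A-P1-REPORT §29, SPEC A).  Decides nothing;
nothing here bears on `MatrixDescartes` (stmt-ValiantsHypothesis-18050) or `VP ≠ VNP`.

* `exists_signVar_of_zeros_family` — let `G : ℝ → ℝ` be continuous with a FINITE zero set of at least
  `N ≥ 1` points, and let `P w ε t` (`w` in a finite non-empty index type) be perturbations, continuous in
  `ε` with `P w 0 = G`, such that at every zero `z` of `G`: (a) for every `w`, `P w ε z ≠ 0` for all small
  `ε > 0`; (b) BALANCE: at least half of the `w` make `P w ε z` eventually negative and at least half make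
  it eventually positive.  Then for some member `w` and some `ε` the function `P w ε` has at least `N`
  consecutive SIGN VARIATIONS along a strictly increasing point sequence.  (Double counting over the family
  picks one `w` flipping ≥ half of the touching zeros; crossing zeros persist; points `ρ_j < g_j < λ_j`.)
  For symmetric `m × m` pencils, `P w ε t = det(F(t) + ε e^{δ₀t} W_w)` and (a)/(b) are the leading-order
  facts `det(F + εW) = ε^{corank}·(…) + O(ε^{corank+1})` for a family closed under `W ↦ −W` plus one
  indefinite member (m = 2: `{±[[1,c],[c,c²±1]]}`; m = 3: `{±I, ±(I − (1+κ)nnᵀ)}`, §29).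

[folklore] Elementary counting; IVT-free (the zeros are given); Laguerre not needed here.
-/

-- `Summit.ValiantsHypothesis.ValiantsHypothesis.…` repeats a component by the D-0017 layout
-- (single-conjunct summit), which the `dupNamespace` linter flags; the name is mandated.
set_option linter.dupNamespace false

namespace Summit.ValiantsHypothesis.ValiantsHypothesis.Theorems.LacunarySymmetroidMatrixDescartes.Census.RealExp

open Finset Filter Topology
open scoped BigOperators

section Family

-- One long elementary proof (finite bookkeeping over the zeros); measured above the default budget.
set_option maxHeartbeats 800000 in
open Classical in
/-- **Zeros ⇒ sign variations for a balanced perturbation family** (module docstring). [folklore] -/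
theorem exists_signVar_of_zeros_family {ι : Type*} [Fintype ι] [Nonempty ι] (G : ℝ → ℝ)
    (hfin : {t : ℝ | G t = 0}.Finite) {N : ℕ} (hN0 : 0 < N) (hN : N ≤ {t : ℝ | G t = 0}.ncard)
    (P : ι → ℝ → ℝ → ℝ) (hP0 : ∀ w t, P w 0 t = G t) (hPcont : ∀ w t, Continuous fun ε => P w ε t)
    (hPne : ∀ w z, G z = 0 → ∀ᶠ ε in 𝓝[>] (0 : ℝ), P w ε z ≠ 0)
    (hbal : ∀ z, G z = 0 →
      Fintype.card ι ≤ 2 * (univ.filter (fun w => ∀ᶠ ε in 𝓝[>] (0 : ℝ), P w ε z < 0)).card ∧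
      Fintype.card ι ≤ 2 * (univ.filter (fun w => ∀ᶠ ε in 𝓝[>] (0 : ℝ), 0 < P w ε z)).card) :
    ∃ (w : ι) (ε : ℝ) (M : ℕ) (p : Fin (M + 1) → ℝ), StrictMono p ∧
      N ≤ (univ.filter (fun i : Fin M => P w ε (p i.castSucc) * P w ε (p i.succ) < 0)).card := by
  classical
  -- the zero set, sorted
  obtain ⟨Zf, hZfmem⟩ : ∃ Zf : Finset ℝ, ∀ x, x ∈ Zf ↔ x ∈ {t : ℝ | G t = 0} :=
    ⟨hfin.toFinset, fun x => hfin.mem_toFinset⟩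
  have hZfeq : (↑Zf : Set ℝ) = {t : ℝ | G t = 0} := Set.ext fun x => hZfmem x
  set n : ℕ := Zf.card with hn
  have hnB : N ≤ n := by rw [hn, ← Set.ncard_coe_finset, hZfeq]; exact hN
  have hn0 : 0 < n := by omega
  set g := Zf.orderEmbOfFin rfl with hg
  have hgmono : StrictMono g := (Zf.orderEmbOfFin rfl).strictMono
  have hgzero : ∀ j, G (g j) = 0 := fun j => (hZfmem _).mp (Finset.orderEmbOfFin_mem Zf rfl j)
  have hall : ∀ t, G t = 0 → ∃ j, g j = t := by
    intro t ht
    have h1 : t ∈ Zf := (hZfmem t).mpr ht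
    have h2 : t ∈ Set.range g := by rw [hg, Finset.range_orderEmbOfFin]; exact h1
    exact h2
  obtain ⟨η, hη, hgap⟩ := exists_third_gap g hgmono
  have hnotzero : ∀ (j : Fin n) (u : ℝ), u = g j - η ∨ u = g j + η → G u ≠ 0 := by
    intro j u hu hGu
    obtain ⟨i, hi⟩ := hall u hGu
    rcases lt_trichotomy i j with hij | rfl | hij
    · have := hgap i j hij; rcases hu with rfl | rfl <;> linarith
    · rcases hu with h | h <;> linarith
    · have := hgap j i hij; rcases hu with rfl | rfl <;> linarith
  have hρ : ∀ j, G (g j - η) ≠ 0 := fun j => hnotzero j _ (Or.inl rfl)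
  have hlam : ∀ j, G (g j + η) ≠ 0 := fun j => hnotzero j _ (Or.inr rfl)
  -- touching / crossing zeros
  set T : Finset (Fin n) := univ.filter (fun j => 0 < G (g j - η) * G (g j + η)) with hT
  set Cr : Finset (Fin n) := univ.filter (fun j => ¬ 0 < G (g j - η) * G (g j + η)) with hCr
  have hTC : T.card + Cr.card = n := by
    have h := Finset.card_filter_add_card_filter_not (s := (univ : Finset (Fin n)))
      (fun j => 0 < G (g j - η) * G (g j + η))
    rw [Finset.card_univ, Fintype.card_fin] at h
    rw [hT, hCr]; exact h
  have hCr_neg : ∀ j ∈ Cr, G (g j - η) * G (g j + η) < 0 := by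
    intro j hj
    rw [hCr, Finset.mem_filter] at hj
    rcases lt_trichotomy (G (g j - η) * G (g j + η)) 0 with h | h | h
    · exact h
    · exact absurd h (mul_ne_zero (hρ j) (hlam j))
    · exact absurd h hj.2
  -- for each zero, the members that flip it; at least half of the family
  set goodset : Fin n → Finset ι := fun j =>
    univ.filter (fun w => ∀ᶠ ε in 𝓝[>] (0 : ℝ), P w ε (g j) * G (g j - η) < 0) with hgoodset
  have hgood_half : ∀ j, Fintype.card ι ≤ 2 * (goodset j).card := by
    intro j
    rcases lt_or_gt_of_ne (hρ j) with hneg | hpos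
    · -- `G(ρ_j) < 0`: the members with `P > 0` eventually are good
      have hsub : univ.filter (fun w => ∀ᶠ ε in 𝓝[>] (0 : ℝ), 0 < P w ε (g j)) ⊆ goodset j := by
        intro w hw
        rw [Finset.mem_filter] at hw
        rw [hgoodset, Finset.mem_filter]
        exact ⟨mem_univ _, hw.2.mono fun ε hε => mul_neg_of_pos_of_neg hε hneg⟩
      exact (hbal (g j) (hgzero j)).2.trans (Nat.mul_le_mul_left 2 (Finset.card_le_card hsub))
    · have hsub : univ.filter (fun w => ∀ᶠ ε in 𝓝[>] (0 : ℝ), P w ε (g j) < 0) ⊆ goodset j := by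
        intro w hw
        rw [Finset.mem_filter] at hw
        rw [hgoodset, Finset.mem_filter]
        exact ⟨mem_univ _, hw.2.mono fun ε hε => mul_neg_of_neg_of_pos hε hpos⟩
      exact (hbal (g j) (hgzero j)).1.trans (Nat.mul_le_mul_left 2 (Finset.card_le_card hsub))
  -- double counting: some member is good for at least half of the touching zeros
  obtain ⟨w, hw⟩ : ∃ w : ι, T.card ≤ 2 * (T.filter (fun j => w ∈ goodset j)).card := by
    by_contra hnone
    push Not at hnone
    have hsum : ∑ w : ι, 2 * (T.filter (fun j => w ∈ goodset j)).card < ∑ w : ι, T.card :=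
      Finset.sum_lt_sum_of_nonempty univ_nonempty fun w _ => hnone w
    have hrhs : ∑ w : ι, T.card = Fintype.card ι * T.card := by
      rw [Finset.sum_const, smul_eq_mul, Finset.card_univ]
    have hswap : ∑ w : ι, (T.filter (fun j => w ∈ goodset j)).card = ∑ j ∈ T, (goodset j).card := by
      simp_rw [Finset.card_filter]
      rw [Finset.sum_comm]
      refine Finset.sum_congr rfl fun j _ => ?_
      rw [hgoodset, Finset.card_filter]
      refine Finset.sum_congr rfl fun w _ => ?_
      simp only [Finset.mem_filter, Finset.mem_univ, true_and]
    have hlhs : ∑ w : ι, 2 * (T.filter (fun j => w ∈ goodset j)).card = 2 * ∑ j ∈ T, (goodset j).card := by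
      rw [← Finset.mul_sum, hswap]
    have hge : Fintype.card ι * T.card ≤ 2 * ∑ j ∈ T, (goodset j).card := by
      rw [Finset.mul_sum, mul_comm, ← smul_eq_mul, ← Finset.sum_const]
      exact Finset.sum_le_sum fun j _ => hgood_half j
    rw [hlhs, hrhs] at hsum
    omega
  set Good : Finset (Fin n) := T.filter (fun j => w ∈ goodset j) with hGood
  -- pick `ε`
  have hev_keep : ∀ u : ℝ, G u ≠ 0 → ∀ᶠ ε in 𝓝[>] (0 : ℝ), 0 < P w ε u * G u := by
    intro u hu
    have hpos : 0 < P w 0 u * G u := by rw [hP0]; exact mul_self_pos.mpr hu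
    have hcont : ContinuousAt (fun ε => P w ε u * G u) 0 := ((hPcont w u).mul continuous_const).continuousAt
    exact (hcont.eventually (lt_mem_nhds hpos)).filter_mono nhdsWithin_le_nhds
  have hev_all : ∀ᶠ ε in 𝓝[>] (0 : ℝ), (∀ j : Fin n, 0 < P w ε (g j - η) * G (g j - η)) ∧
      (∀ j : Fin n, 0 < P w ε (g j + η) * G (g j + η)) ∧
      (∀ j : Fin n, j ∈ Good → P w ε (g j) * G (g j - η) < 0) ∧
      (∀ j : Fin n, P w ε (g j) ≠ 0) := by
    refine (eventually_all.mpr fun j => hev_keep _ (hρ j)).and ((eventually_all.mpr fun j =>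
      hev_keep _ (hlam j)).and ((eventually_all.mpr fun j => ?_).and
      (eventually_all.mpr fun j => hPne w (g j) (hgzero j))))
    by_cases hj : j ∈ Good
    · have hj' : w ∈ goodset j := by rw [hGood, Finset.mem_filter] at hj; exact hj.2
      rw [hgoodset, Finset.mem_filter] at hj'
      exact hj'.2.mono fun ε h _ => h
    · exact Eventually.of_forall fun ε h => absurd h hj
  obtain ⟨ε, hkeepρ, hkeepl, hgood, hne⟩ := hev_all.exists
  set Q : ℝ → ℝ := P w ε with hQ
  -- the point sequence
  obtain ⟨Pt, hPtmono, hPt⟩ := exists_pointSeq hn0 g hgmono hη hgap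
  set M : ℕ := 3 * n with hM
  set p : Fin (M + 1) → ℝ := fun i => Pt i with hp
  have hpmono : StrictMono p := fun i j hij => hPtmono (Fin.lt_def.mp hij)
  -- the bound from the integer row
  -- block indices
  have hb0lt : ∀ j : Fin n, 3 * (j : ℕ) < M := fun j => by omega
  have hb1lt : ∀ j : Fin n, 3 * (j : ℕ) + 1 < M := fun j => by omega
  set b0 : Fin n → Fin M := fun j => ⟨3 * j, hb0lt j⟩ with hb0
  set b1 : Fin n → Fin M := fun j => ⟨3 * j + 1, hb1lt j⟩ with hb1
  have hp_b0c : ∀ j, p (b0 j).castSucc = g j - η := fun j => by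
    simp only [hp, hb0, Fin.val_castSucc]; exact (hPt j).1
  have hp_b0s : ∀ j, p (b0 j).succ = g j := fun j => by
    simp only [hp, hb0, Fin.val_succ]; exact (hPt j).2.1
  have hp_b1c : ∀ j, p (b1 j).castSucc = g j := fun j => by
    simp only [hp, hb1, Fin.val_castSucc]; exact (hPt j).2.1
  have hp_b1s : ∀ j, p (b1 j).succ = g j + η := fun j => by
    simp only [hp, hb1, Fin.val_succ]; rw [show 3 * (j : ℕ) + 1 + 1 = 3 * (j : ℕ) + 2 by ring]
    exact (hPt j).2.2
  set I : Finset (Fin M) := univ.filter (fun i : Fin M => Q (p i.castSucc) * Q (p i.succ) < 0) with hI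
  -- membership of the three families
  have hGoodT : ∀ j ∈ Good, j ∈ T := fun j hj => by
    rw [hGood, Finset.mem_filter] at hj; exact hj.1
  have hGood_sign : ∀ j ∈ Good, Q (g j) * G (g j - η) < 0 := fun j hj => hgood j hj
  have hmem0 : ∀ j ∈ Good, b0 j ∈ I := by
    intro j hj
    rw [hI, Finset.mem_filter, hp_b0c, hp_b0s]
    refine ⟨mem_univ _, ?_⟩
    -- signs: Gp(ρ) ~ G(ρ), Gp(g) ~ -G(ρ)
    exact mul_neg_of_keep_of_flip (hkeepρ j) (hGood_sign j hj)
  have hmem1 : ∀ j ∈ Good, b1 j ∈ I := by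
    intro j hj
    rw [hI, Finset.mem_filter, hp_b1c, hp_b1s]
    refine ⟨mem_univ _, ?_⟩
    have hTj : 0 < G (g j - η) * G (g j + η) := by
      have := hGoodT j hj; rw [hT, Finset.mem_filter] at this; exact this.2
    exact mul_neg_of_keep_of_flip' (hkeepl j) (hGood_sign j hj) hTj
  set χ : Fin n → Fin M := fun j => if Q (g j - η) * Q (g j) < 0 then b0 j else b1 j with hχ
  have hmemχ : ∀ j ∈ Cr, χ j ∈ I := by
    intro j hj
    have hneg := hCr_neg j hj
    have h1 := hkeepρ j
    have h3 := hkeepl j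
    have hgj := hne j
    by_cases hcase : Q (g j - η) * Q (g j) < 0
    · have : χ j = b0 j := by rw [hχ]; simp only [hcase, if_true]
      rw [this, hI, Finset.mem_filter, hp_b0c, hp_b0s]
      exact ⟨mem_univ _, hcase⟩
    · have : χ j = b1 j := by rw [hχ]; simp only [hcase, if_false]
      rw [this, hI, Finset.mem_filter, hp_b1c, hp_b1s]
      refine ⟨mem_univ _, ?_⟩
      push Not at hcase
      exact mul_neg_of_not_first (mul_neg_of_keep_keep h1 h3 hneg) hgj hcase
  -- counting
  have hinj0 : Function.Injective b0 := fun i j h => by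
    have := congrArg Fin.val h; simp only [hb0] at this; exact Fin.ext (by omega)
  have hinj1 : Function.Injective b1 := fun i j h => by
    have := congrArg Fin.val h; simp only [hb1] at this; exact Fin.ext (by omega)
  have hχval : ∀ j, (χ j : ℕ) = 3 * j ∨ (χ j : ℕ) = 3 * j + 1 := by
    intro j; rw [hχ]; simp only []; split_ifs <;> simp [hb0, hb1]
  have hinjχ : Set.InjOn χ ↑Cr := fun i _ j _ h => by
    have := congrArg Fin.val h
    rcases hχval i with hi | hi <;> rcases hχval j with hj' | hj' <;> rw [hi, hj'] at this <;>
      exact Fin.ext (by omega)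
  have hsub : Good.image b0 ∪ Good.image b1 ∪ Cr.image χ ⊆ I := by
    intro x hx
    rw [Finset.mem_union, Finset.mem_union, Finset.mem_image, Finset.mem_image, Finset.mem_image] at hx
    rcases hx with (⟨j, hj, rfl⟩ | ⟨j, hj, rfl⟩) | ⟨j, hj, rfl⟩
    · exact hmem0 j hj
    · exact hmem1 j hj
    · exact hmemχ j hj
  have hGoodCr : ∀ j ∈ Good, j ∉ Cr := by
    intro j hj hjC
    have h1 := hGoodT j hj
    rw [hT, Finset.mem_filter] at h1
    rw [hCr, Finset.mem_filter] at hjC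
    exact hjC.2 h1.2
  have hdisj01 : Disjoint (Good.image b0) (Good.image b1) := by
    rw [Finset.disjoint_left]
    rintro x hx0 hx1
    rw [Finset.mem_image] at hx0 hx1
    obtain ⟨i, -, rfl⟩ := hx0
    obtain ⟨j, -, hj⟩ := hx1
    have := congrArg Fin.val hj; simp only [hb0, hb1] at this; omega
  have hdisj2 : Disjoint (Good.image b0 ∪ Good.image b1) (Cr.image χ) := by
    rw [Finset.disjoint_left]
    rintro x hx hxC
    rw [Finset.mem_image] at hxC
    obtain ⟨j, hjC, rfl⟩ := hxC
    rw [Finset.mem_union, Finset.mem_image, Finset.mem_image] at hx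
    rcases hx with ⟨i, hi, hij⟩ | ⟨i, hi, hij⟩
    · have hv := congrArg Fin.val hij; simp only [hb0] at hv
      have : i = j := by rcases hχval j with h | h <;> rw [h] at hv <;> exact Fin.ext (by omega)
      exact hGoodCr i hi (this ▸ hjC)
    · have hv := congrArg Fin.val hij; simp only [hb1] at hv
      have : i = j := by rcases hχval j with h | h <;> rw [h] at hv <;> exact Fin.ext (by omega)
      exact hGoodCr i hi (this ▸ hjC)
  have hcardI : 2 * Good.card + Cr.card ≤ I.card := by
    have h1 := Finset.card_le_card hsub
    rw [Finset.card_union_of_disjoint hdisj2, Finset.card_union_of_disjoint hdisj01,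
      Finset.card_image_of_injective _ hinj0, Finset.card_image_of_injective _ hinj1,
      Finset.card_image_of_injOn hinjχ] at h1
    omega
  refine ⟨w, ε, M, p, hpmono, ?_⟩
  change N ≤ I.card
  omega

end Family

end Summit.ValiantsHypothesis.ValiantsHypothesis.Theorems.LacunarySymmetroidMatrixDescartes.Census.RealExp
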